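import Summits.BirchSwinnertonDyer.BirchSwinnertonDyer.Theorems.KatoDescentTamePotSupersingularCartanMuRoadRealDoorsTprime
import Summits.BirchSwinnertonDyer.BirchSwinnertonDyer.Theorems.KatoDescentTamePotSupersingularTameUpperUnitTwistRecordsTprimeThree11
import Summits.BirchSwinnertonDyer.BirchSwinnertonDyer.Theorems.KatoDescentTamePotSupersingularTameUpperUnitTwistRecordsImageThree01
import Summits.BirchSwinnertonDyer.BirchSwinnertonDyer.Theorems.KatoDescentTamePotSupersingularTameUpperUnitTwistRecordsImageThree08
import Summits.BirchSwinnertonDyer.BirchSwinnertonDyer.Theorems.Rank1ResidualIntModelReduction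
import Summits.BirchSwinnertonDyer.Rank1Residual.Supersingular.CountPointsFast
import Summits.BirchSwinnertonDyer.Rank1Residual.Additive.X4ThreeResCertKernel
import Summits.BirchSwinnertonDyer.Rank1Residual.X11b.CertificateCheckBridge
import HarnessLib

/-!
# Route `KatoDescentTamePotSupersingular` (rung K8, sub-rung B4 (t′), cell `bsd-potss`): the `p = 3` RESIDUE ROWS of the Conj-A crux
# `TameCoatesSujathaResidue` (item 19916; U₀-ns node 19202 → parent 19982) on the CARTAN μ-ROAD — per-row (A) / U₀ records from ONE
# classical `μ`-hypothesis (rows 130095bp1, 470304m1; seat `bsd-potss-k8t-c4` g16; KT twin of k9-c4 g18's `…WildConjAResidueCartanRows*`;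
# `--supports stmt-BirchSwinnertonDyer-19982 --as helper`)

HONEST FRAMING. THEOREMS ONLY (no definition, no named fact, no `sorry`); PER ROW — NOT a class theorem; nothing is booked; items 19916 /
19202 / 19982 stay OPEN at class level (their class-wide open inputs are the zeta crux 24439 `TameKatoZetaIndivisible` and the lower half of
the residual 19984; the Cartan μ-road is a SECOND, lemma-level road for the Conj-A residue rows); Coates–Sujatha's (A), Conjecture A and BSD
are proved for NO curve here. The KT census (HOME/k8t-c4/KT-19413-anchor-census-g4.tsv, g13/g14 unit-twist censuses) has exactly THREE
residue rows of 19916 — the multi-Tamagawa rows 130095bp1 @3 (`3Nn`), 470304m1 @3 (`3Nn`), 283200gf1 @5 (`5Ns`): `p ∣ ∏c_ℓ` carried by two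
multiplicative primes, so neither unit-twist road applies (k8t-c4 g14 §3(b)). This file records the two `p = 3` rows; 283200gf1 (`p = 5`)
has no Cartan μ-door in the tree (the road is typed at `p = 3`).
ROAD (conjA-anchor g11 N3/N4 p620354/p620850 ∘ k9-c4 g18's doors `CartanMuRoadRealDoors` p626162 ∘ this seat's (t′) doors
`CartanMuRoadRealDoorsTprime`): on a `3Nn` row, statement (A) at `(E, 3)` — and then U₀ `MissingUpperBoundAt E 3` by the fine-Selmer port of
Kato 14.5 (3) on an irreducible rank-`0` (t′) row (Kato A161-fine + GZK + modularity) — follows from the NAMED FACTS Coates–Sujatha 2005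
Thm. 3.4 (`hCS`), Ferrero–Washington (`hFW`), Iwasawa's growth theorem (`hI`) and ONE classical hypothesis: Iwasawa's `μ = 0` for the
cyclotomic `ℤ_3`-extension of the MAXIMAL REAL SUBFIELD `ℚ(E[3])⁺` (the fixed field of a complex conjugation `c` restricted to `ℚ(E[3])`;
`= ℚ(P)` for a real `3`-torsion point `P`, of degree `8` on `3Nn` rows) — the involution binders of the road being DISCHARGED by `c`.
IN THE KERNEL per row: `E[3]` irreducible (Frobenius witness, this file); REUSED from the tree (k8t-c4 g15): `Δ ≠ 0`, global minimality
(Kraus), `Addv E 3` and the (t′) membership `SubTprime E 3` (Kodaira III / III* at 3, `…RecordsTprimeThree11`), `Δ = d³ ⟹ ρ̄₃ not onto`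
(`…RecordsImageThree01/08`, quoted), Cremona's `N` (`…RecordsConductor02/33`, quoted). DISPLAYED per row: the named facts; Cremona's
`r_an = 0` (`hr`); the image EQUALITY `HasModPImageEqNonsplitCartanNormalizer E 3` (census/LMFDB `3Nn`; its kernel certificate would need
the irreducibility of `Ψ₃` over `ℚ` — not attempted); the `μ`-hypothesis `hμ`.

References: [CoatesSujatha2005] Thm. 3.4; [Kato2004Asterisque] Thm. 12.5 (3), 14.5 (3); [Serre1972] §2.2, §5.2; [Washington1997] §7.5, §13.1;
[Mazur1978] §6; [IrelandRosen1990] §5, §8; [Cremona2006] Table 1.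
-/

set_option autoImplicit false
set_option linter.dupNamespace false

noncomputable section

open scoped Classical NumberField
open WeierstrassCurve NumberField Field IntermediateField
  Literature.NumberTheory.EllipticCurves Literature.NumberTheory.EllipticCurves.Rank1Residual
  Literature.NumberTheory.EllipticCurves.Rank1Residual.Typed
  Literature.NumberTheory.EllipticCurves.Rank1Residual.X11RankOneCertificates
  Literature.NumberTheory.GaloisRepresentations Literature.NumberTheory.SerreUniformity Literature.NumberTheory.IwasawaTheory
  Summit.BirchSwinnertonDyer.BirchSwinnertonDyer.Rank1Residual.IntModel
  Summit.BirchSwinnertonDyer.Rank1Residual Summit.BirchSwinnertonDyer.Rank1Residual.Additive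
  Summit.BirchSwinnertonDyer.Rank1Residual.Supersingular Summit.BirchSwinnertonDyer.Rank1Residual.X11b
  Summit.BirchSwinnertonDyer.BirchSwinnertonDyer.Theorems

namespace Summit.BirchSwinnertonDyer.BirchSwinnertonDyer.Theorems.TameUpperUnitTwistRecords

/-! ### `130095bp1` @ `p = 3` — `N = 130095 = 3^2·5·7^2·59`; Cremona: `r_an = 0` (displayed where used); (t′) at `3`: `e = 4` (Kodaira III,
`kodairaSymbolAt_g130095bp1_3` / `subTprime_g130095bp1_3` in `…RecordsTprimeThree11`); mod-`3` image `3Nn` (census) — `Δ = d³ ⟹ ρ̄₃ not onto` is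
`notSurjThree_g130095bp1` (`…RecordsImageThree01`), the EQUALITY with `C_ns⁺(3)` displayed; Tamagawa: c₅ = 9, c₅₉ = 3 (c₃ = 2, c₇ = 2): ∏c = 108, v₃ = 3, carriers {5, 59} — a RESIDUE row of
`TameCoatesSujathaResidue` (19916): no single-carrier unit-twist road (k8t-c4 g14 §3(b)); `N(E)` is `conductorNorm_g130095bp1` (`…RecordsConductor02`). -/

/-- **`E[3]` IRREDUCIBLE for `E = 130095bp1`** (kernel; Frobenius witness `ℓ = 11`: `#Ẽ(𝔽_{11}) = 7`, `a_{11} = 5`, `X² − (5)X + 11`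
has no root mod `3`; `IntModel.hasIrreducibleModPGaloisRep_of_intModel_of_noroot`). [cite: Mazur1978, §6 Prop. 6.3 (1) (p. 153)]
[cite: IrelandRosen1990, Prop. 5.1.2 and §8.1] [cite: Cremona2006, Table 1 (Cremona label 130095bp1)] -/
theorem irr_g130095bp1_3 : (⟨0, 0, 1, (-610197), (-1022424433)⟩ : WeierstrassCurve ℚ).HasIrreducibleModPGaloisRep 3 := by
  have hnr : ∀ t : ZMod 3, t ^ 2 - ((((11 : ℕ) : ℤ) + 1 - ((7 : ℕ) : ℤ) : ℤ) : ZMod 3) * t + ((11 : ℕ) : ZMod 3) ≠ 0 := by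
    decide
  haveI := isElliptic_g130095bp1
  haveI := isGloballyMinimal_g130095bp1
  haveI : Fact (Nat.Prime 11) := ⟨by norm_num⟩
  have hI : integralModelInt (⟨0, 0, 1, (-610197), (-1022424433)⟩ : WeierstrassCurve ℚ) = (⟨0, 0, 1, (-610197), (-1022424433)⟩ : WeierstrassCurve ℤ) :=
    integralModelInt_eq_of_map_eq _ (map_mk_int 0 0 1 (-610197) (-1022424433))
  have hc : Nat.card (((((⟨0, 0, 1, (-610197), (-1022424433)⟩ : WeierstrassCurve ℤ))).map (Int.castRingHom (ZMod 11))).toAffine.Point) = 7 := by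
    have h := natCard_point_eq_countPoints 0 0 1 (-610197) (-1022424433) 11 (by norm_num) (by decide +kernel)
    have h' : countPoints [0, 0, 1, (-610197), (-1022424433)] 11 = 7 := countPoints_eq_of_fast (by decide +kernel)
    exact_mod_cast h.trans h'
  exact hasIrreducibleModPGaloisRep_of_intModel_of_noroot hI 3 11 (by norm_num) (by decide +kernel) hc hnr

/-- **(A) at `(130095bp1, 3)` from ONE classical `μ`-hypothesis** — the conclusion of `TameCoatesSujathaResidue` (19916) AT THIS ROW: for every
cyclotomic `ℤ_3`-extension `κ` of `ℚ`, the dual fine Selmer group of `E` over `ℚ_cyc` is finitely generated over `ℤ_3`, from the NAMED FACTS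
`hCS` (Coates–Sujatha Thm. 3.4), `hI` (Iwasawa's growth theorem), `hFW` (Ferrero–Washington), the DISPLAYED image equality `3Nn` (`himg`),
a complex conjugation `c`, and `μ = 0` for every cyclotomic `ℤ_3`-extension of `ℚ(E[3])⁺ = ℚ(P)` (degree `8`; `hμ`). Door:
`CartanMuRoadRealDoors.conjA_three_of_hasModPImageEqNonsplitCartanNormalizer_of_realMu'` (k9-c4 g18). CONDITIONAL; (A) is asserted
for no curve. [cite: CoatesSujatha2005, Thm. 3.4 (§3)] [cite: Serre1972, §2.2, §5.2 (iv)] [cite: Washington1997, §13.1]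
[cite: Cremona2006, Table 1 (Cremona label 130095bp1)] -/
theorem conjA_g130095bp1_3
    (hCS : CoatesSujatha2005.thm34_fineSelmerDual_moduleFinite_of_classicalMuVanishes_divisionField)
    (hI : iwasawa1959_classNumberPExp_growth) (hFW : ferreroWashington1979_classicalMuVanishes)
    {W : WeierstrassCurve ℚ} [W.IsElliptic] (hWeq : W = (⟨0, 0, 1, (-610197), (-1022424433)⟩ : WeierstrassCurve ℚ)) (himg : HasModPImageEqNonsplitCartanNormalizer W 3)
    {c : absoluteGaloisGroup ℚ} (hc : IsComplexConjugation (Rat.castHom ℝ) c)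
    (hμ : ∀ κE : ZpExtension ↥(fixedField (Subgroup.zpowers (absRestrictNormalHom (W.divisionField 3) c))) 3,
      κE.IsCyclotomic → ClassicalMuVanishes κE)
    (κ : ZpExtension ℚ 3) (hκ : κ.IsCyclotomic) :
    ∃ (γ : absoluteGaloisGroup ℚ) (Df : W.FineSelmerDualData κ γ),
      Module.Finite ℤ_[3] (RestrictScalars ℤ_[3] (IwasawaAlgebra 3) Df.X) := by
  subst hWeq
  exact CartanMuRoadRealDoors.conjA_three_of_hasModPImageEqNonsplitCartanNormalizer_of_realMu' _ hCS hI hFW himg hc hμ κ hκ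

/-- **RECORD — UPPER half `ord₃ #Ш(E) ≤ ord₃ #Ш(E)_an` for `E = 130095bp1` at `p = 3`** (a Conj-A RESIDUE row of the U₀-ns node 19202 / item
19982), by the Cartan μ-road: the (t′) door `CartanMuRoadRealDoorsTprime.missingUpperBoundAt_three_tame_of_hasModPImageEqNonsplitCartanNormalizer_of_realMu'`
(fine-Selmer port of Kato 14.5 (3) ∘ (A) from `hμ`). KERNEL: `E[3]` irreducible (`irr_g130095bp1_3`), `Addv E 3` and `SubTprime E 3`
(`addv_g130095bp1_3`, `subTprime_g130095bp1_3`, reused from `…RecordsTprimeThree11`). DISPLAYED: the named facts `hKatoA hGZK hmod hCS hI hFW`;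
Cremona's `r_an = 0` (`hr`); the image equality `3Nn` (`himg`); the complex conjugation `c`; the `μ`-hypothesis for `ℚ(P)` (`hμ`). Per row;
nothing booked; BSD is not proved by this. [cite: Kato2004Asterisque, Thm. 14.5 (3) (p. 236), Thm. 12.5 (3) (p. 222)]
[cite: CoatesSujatha2005, Thm. 3.4 (§3)] [cite: Washington1997, §13.1] [cite: Miller2011LMS, Def. 1.1] [cite: Cremona2006, Table 1 (Cremona label 130095bp1)] -/
theorem missingUpperBoundAt_g130095bp1_3
    (hKatoA : Kato2004.rankZero_padicValNat_sha_add_padicValNat_tamagawa_le_of_additive_potGood_of_irreducible_of_fineSelmerDual_fg)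
    (hGZK : rank_eq_analyticRank_of_analyticRank_le_one) (hmod : hasEntireLFunction_rat)
    (hCS : CoatesSujatha2005.thm34_fineSelmerDual_moduleFinite_of_classicalMuVanishes_divisionField)
    (hI : iwasawa1959_classNumberPExp_growth) (hFW : ferreroWashington1979_classicalMuVanishes)
    {W : WeierstrassCurve ℚ} [W.IsElliptic] [W.IsGloballyMinimal] (hWeq : W = (⟨0, 0, 1, (-610197), (-1022424433)⟩ : WeierstrassCurve ℚ)) (hr : W.analyticRank = 0)
    (himg : HasModPImageEqNonsplitCartanNormalizer W 3)
    {c : absoluteGaloisGroup ℚ} (hc : IsComplexConjugation (Rat.castHom ℝ) c)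
    (hμ : ∀ κE : ZpExtension ↥(fixedField (Subgroup.zpowers (absRestrictNormalHom (W.divisionField 3) c))) 3,
      κE.IsCyclotomic → ClassicalMuVanishes κE) :
    MissingUpperBoundAt W 3 := by
  subst hWeq
  haveI : Fact (Nat.Prime 3) := ⟨Nat.prime_three⟩
  exact CartanMuRoadRealDoorsTprime.missingUpperBoundAt_three_tame_of_hasModPImageEqNonsplitCartanNormalizer_of_realMu' _ hKatoA hGZK
    hmod hCS hI hFW hr addv_g130095bp1_3 subTprime_g130095bp1_3 irr_g130095bp1_3 himg hc hμ

/-! ### `470304m1` @ `p = 3` — `N = 470304 = 2^5·3^2·23·71`; Cremona: `r_an = 0` (displayed where used); (t′) at `3`: `e = 4` (Kodaira III*,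
`kodairaSymbolAt_g470304m1_3` / `subTprime_g470304m1_3` in `…RecordsTprimeThree11`); mod-`3` image `3Nn` (census) — `Δ = d³ ⟹ ρ̄₃ not onto` is
`notSurjThree_g470304m1` (`…RecordsImageThree08`), the EQUALITY with `C_ns⁺(3)` displayed; Tamagawa: c₂₃ = 3, c₇₁ = 3 (c₂ = 2, c₃ = 2): ∏c = 36, v₃ = 2, carriers {23, 71} — a RESIDUE row of
`TameCoatesSujathaResidue` (19916): no single-carrier unit-twist road (k8t-c4 g14 §3(b)); `N(E)` is `conductorNorm_g470304m1` (`…RecordsConductor33`). -/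

/-- **`E[3]` IRREDUCIBLE for `E = 470304m1`** (kernel; Frobenius witness `ℓ = 5`: `#Ẽ(𝔽_{5}) = 5`, `a_{5} = 1`, `X² − (1)X + 5`
has no root mod `3`; `IntModel.hasIrreducibleModPGaloisRep_of_intModel_of_noroot`). [cite: Mazur1978, §6 Prop. 6.3 (1) (p. 153)]
[cite: IrelandRosen1990, Prop. 5.1.2 and §8.1] [cite: Cremona2006, Table 1 (Cremona label 470304m1)] -/
theorem irr_g470304m1_3 : (⟨0, 0, 0, (-1109592), (-450778608)⟩ : WeierstrassCurve ℚ).HasIrreducibleModPGaloisRep 3 := by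
  have hnr : ∀ t : ZMod 3, t ^ 2 - ((((5 : ℕ) : ℤ) + 1 - ((5 : ℕ) : ℤ) : ℤ) : ZMod 3) * t + ((5 : ℕ) : ZMod 3) ≠ 0 := by
    decide
  haveI := isElliptic_g470304m1
  haveI := isGloballyMinimal_g470304m1
  haveI : Fact (Nat.Prime 5) := ⟨by norm_num⟩
  have hI : integralModelInt (⟨0, 0, 0, (-1109592), (-450778608)⟩ : WeierstrassCurve ℚ) = (⟨0, 0, 0, (-1109592), (-450778608)⟩ : WeierstrassCurve ℤ) :=
    integralModelInt_eq_of_map_eq _ (map_mk_int 0 0 0 (-1109592) (-450778608))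
  have hc : Nat.card (((((⟨0, 0, 0, (-1109592), (-450778608)⟩ : WeierstrassCurve ℤ))).map (Int.castRingHom (ZMod 5))).toAffine.Point) = 5 := by
    have h := natCard_point_eq_countPoints 0 0 0 (-1109592) (-450778608) 5 (by norm_num) (by decide +kernel)
    have h' : countPoints [0, 0, 0, (-1109592), (-450778608)] 5 = 5 := countPoints_eq_of_fast (by decide +kernel)
    exact_mod_cast h.trans h'
  exact hasIrreducibleModPGaloisRep_of_intModel_of_noroot hI 3 5 (by norm_num) (by decide +kernel) hc hnr

/-- **(A) at `(470304m1, 3)` from ONE classical `μ`-hypothesis** — the conclusion of `TameCoatesSujathaResidue` (19916) AT THIS ROW: for every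
cyclotomic `ℤ_3`-extension `κ` of `ℚ`, the dual fine Selmer group of `E` over `ℚ_cyc` is finitely generated over `ℤ_3`, from the NAMED FACTS
`hCS` (Coates–Sujatha Thm. 3.4), `hI` (Iwasawa's growth theorem), `hFW` (Ferrero–Washington), the DISPLAYED image equality `3Nn` (`himg`),
a complex conjugation `c`, and `μ = 0` for every cyclotomic `ℤ_3`-extension of `ℚ(E[3])⁺ = ℚ(P)` (degree `8`; `hμ`). Door:
`CartanMuRoadRealDoors.conjA_three_of_hasModPImageEqNonsplitCartanNormalizer_of_realMu'` (k9-c4 g18). CONDITIONAL; (A) is asserted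
for no curve. [cite: CoatesSujatha2005, Thm. 3.4 (§3)] [cite: Serre1972, §2.2, §5.2 (iv)] [cite: Washington1997, §13.1]
[cite: Cremona2006, Table 1 (Cremona label 470304m1)] -/
theorem conjA_g470304m1_3
    (hCS : CoatesSujatha2005.thm34_fineSelmerDual_moduleFinite_of_classicalMuVanishes_divisionField)
    (hI : iwasawa1959_classNumberPExp_growth) (hFW : ferreroWashington1979_classicalMuVanishes)
    {W : WeierstrassCurve ℚ} [W.IsElliptic] (hWeq : W = (⟨0, 0, 0, (-1109592), (-450778608)⟩ : WeierstrassCurve ℚ)) (himg : HasModPImageEqNonsplitCartanNormalizer W 3)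
    {c : absoluteGaloisGroup ℚ} (hc : IsComplexConjugation (Rat.castHom ℝ) c)
    (hμ : ∀ κE : ZpExtension ↥(fixedField (Subgroup.zpowers (absRestrictNormalHom (W.divisionField 3) c))) 3,
      κE.IsCyclotomic → ClassicalMuVanishes κE)
    (κ : ZpExtension ℚ 3) (hκ : κ.IsCyclotomic) :
    ∃ (γ : absoluteGaloisGroup ℚ) (Df : W.FineSelmerDualData κ γ),
      Module.Finite ℤ_[3] (RestrictScalars ℤ_[3] (IwasawaAlgebra 3) Df.X) := by
  subst hWeq
  exact CartanMuRoadRealDoors.conjA_three_of_hasModPImageEqNonsplitCartanNormalizer_of_realMu' _ hCS hI hFW himg hc hμ κ hκ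

/-- **RECORD — UPPER half `ord₃ #Ш(E) ≤ ord₃ #Ш(E)_an` for `E = 470304m1` at `p = 3`** (a Conj-A RESIDUE row of the U₀-ns node 19202 / item
19982), by the Cartan μ-road: the (t′) door `CartanMuRoadRealDoorsTprime.missingUpperBoundAt_three_tame_of_hasModPImageEqNonsplitCartanNormalizer_of_realMu'`
(fine-Selmer port of Kato 14.5 (3) ∘ (A) from `hμ`). KERNEL: `E[3]` irreducible (`irr_g470304m1_3`), `Addv E 3` and `SubTprime E 3`
(`addv_g470304m1_3`, `subTprime_g470304m1_3`, reused from `…RecordsTprimeThree11`). DISPLAYED: the named facts `hKatoA hGZK hmod hCS hI hFW`;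
Cremona's `r_an = 0` (`hr`); the image equality `3Nn` (`himg`); the complex conjugation `c`; the `μ`-hypothesis for `ℚ(P)` (`hμ`). Per row;
nothing booked; BSD is not proved by this. [cite: Kato2004Asterisque, Thm. 14.5 (3) (p. 236), Thm. 12.5 (3) (p. 222)]
[cite: CoatesSujatha2005, Thm. 3.4 (§3)] [cite: Washington1997, §13.1] [cite: Miller2011LMS, Def. 1.1] [cite: Cremona2006, Table 1 (Cremona label 470304m1)] -/
theorem missingUpperBoundAt_g470304m1_3
    (hKatoA : Kato2004.rankZero_padicValNat_sha_add_padicValNat_tamagawa_le_of_additive_potGood_of_irreducible_of_fineSelmerDual_fg)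
    (hGZK : rank_eq_analyticRank_of_analyticRank_le_one) (hmod : hasEntireLFunction_rat)
    (hCS : CoatesSujatha2005.thm34_fineSelmerDual_moduleFinite_of_classicalMuVanishes_divisionField)
    (hI : iwasawa1959_classNumberPExp_growth) (hFW : ferreroWashington1979_classicalMuVanishes)
    {W : WeierstrassCurve ℚ} [W.IsElliptic] [W.IsGloballyMinimal] (hWeq : W = (⟨0, 0, 0, (-1109592), (-450778608)⟩ : WeierstrassCurve ℚ)) (hr : W.analyticRank = 0)
    (himg : HasModPImageEqNonsplitCartanNormalizer W 3)
    {c : absoluteGaloisGroup ℚ} (hc : IsComplexConjugation (Rat.castHom ℝ) c)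
    (hμ : ∀ κE : ZpExtension ↥(fixedField (Subgroup.zpowers (absRestrictNormalHom (W.divisionField 3) c))) 3,
      κE.IsCyclotomic → ClassicalMuVanishes κE) :
    MissingUpperBoundAt W 3 := by
  subst hWeq
  haveI : Fact (Nat.Prime 3) := ⟨Nat.prime_three⟩
  exact CartanMuRoadRealDoorsTprime.missingUpperBoundAt_three_tame_of_hasModPImageEqNonsplitCartanNormalizer_of_realMu' _ hKatoA hGZK
    hmod hCS hI hFW hr addv_g470304m1_3 subTprime_g470304m1_3 irr_g470304m1_3 himg hc hμ

end Summit.BirchSwinnertonDyer.BirchSwinnertonDyer.Theorems.TameUpperUnitTwistRecords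

end
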